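import Summits.CriticalPhenomena.PercolationContinuityZ3.Theorems.PercNearOneGluingNoHeavyQuantShapeHubNarrow
import Summits.CriticalPhenomena.PercolationContinuityZ3.Theorems.PercNearOneGluingNoHeavyQuantShapeHubWide
import Summits.CriticalPhenomena.PercolationContinuityZ3.Theorems.PercNearOneGluingNoHeavyQuantResidueForestsAll
import HarnessLib

/-!
# QUANT lane R8, T-DEC: EVERY FOREST OF GLUED SIBLINGS `R^lo[q₁](R^K[g₁]) ⊔ … ⊔ R^lo[q_k](R^K[g_k])` OF A COMMON SHAPE `lo < K ≤ 2lo`, ANY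
# PARAMETERS, EVERY WIDTH, IS SDEC AT EVERY TREE-OK FLOOR `x ≤ min qᵢgᵢ` — ORACLE-FREE (census-1 gen 32; extends census-1 g31's
# `sdec_shapeForest` / `sdec_shapeForests_all`, which needed `2K ≤ 3lo`)

builds on p205010 (kernel theorem, internal audit signed; external expert review pending)

Support file (`--supports stmt-CriticalPhenomena-4575`), QUANT lane seat prim-quant-census-1 (gen 32); memo
`run/shared/lean/prim/quant/prim-quant-census-1/g32/TWOLO-G32.md` §1–§2.  Theorems only (no definitions), standard axioms, no sorries.  Uses the
hubs of every width for `K ≤ 2lo` (`sdec_sHub_two` / `sdec_sHub_three` of `…QuantShapeHubNarrow`, `sdec_sHub_wide` of `…QuantShapeHubWide`), g31's piece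
beside a big blob `sdec_pieceBlob` (`…QuantShapePieceBlob`, valid for every `K ≤ 2lo` already), the forced mixture `gate_shapeSib_eq_mix` / `shapeSib_params`
/ `sdec_blob_step` (`…QuantShapeSibling`), `shapeForest_piece` / `shapeSibs_ftop_fmean` (`…QuantShapeForest`) and the tame-sibling adjunction `sdec_append_tame` /
`sdec_flaw_perm` (`…QuantResidueForestsAll`, arm-1 g57's `sdec_cons_of_tame`).

WHAT IS NEW.  g31's one-shape forest theorem was the regime `lo < K ≤ 3lo/2`, where ONE near certificate serves every width `j ≥ 2`; its k-fold piece
expansion (`shapeForest_inv`) used `2K ≤ 3lo` only through the hub lemma `sdec_sHub`.  With the hub of EVERY width now SDEC for every `K ≤ 2lo`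
(`sdec_sHub_twoLo`: widths 2, 3 by the mean-gate binomial-extremality capacity, widths `≥ 4` by the progression criterion), the SAME expansion gives the forest
theorem for every shape `lo < K ≤ 2lo` — e.g. `R²(R⁴)`, `R³(R⁵)`, `R³(R⁶)`, `R⁴(R⁷)`, `R⁴(R⁸)`, `R⁵(R⁸..R¹⁰)` join g31's `R²(R³)`, `R³(R⁴)`, `R⁴(R⁵)`, `R⁴(R⁶)`
(and the glued children `R(R²)` of g30/g31, the case `(lo,K) = (1,2)`, are re-proved uniformly).
* **`sdec_sHub_twoLo`** — the sub-floor hub of shape `(lo,K)`, `lo < K ≤ 2lo`, of EVERY width `≥ 2` is SDEC.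
* **`shapeForest_inv_twoLo`** — the invariant of the piece expansion (`sHub P ∗ flaw L` is a law / SDEC unless `|P| = 1 ∧ L = []` / ∗ big blob SDEC).
* **`sdec_shapeForest_twoLo`** — ∀ `lo < K ≤ 2lo`, ∀ `L : List Sib` of siblings `⟨q,·,·,lo+K,S(g)⟩`, `0<q,g<1`, `q(lo+Kg) ≥ 2lo`, `x ≤ qg`; `0 < x` ⟹
  `SDEC x (ftop L) (flaw L)`.
* **`sdec_shapeForests_all_twoLo`** — THE SAME WITH NO PARAMETER RESTRICTION: siblings `⟨q,·,·,lo+K,S(g)⟩`, `0 < q, g < 1`, every floor `0 < x ≤ min qᵢgᵢ`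
  (heavy siblings by the expansion, light ones `q(lo+Kg) < 2lo` are tame).  So the list form of the node `SiblingStep` HOLDS OUTRIGHT on every one-shape
  forest of glued siblings `R^lo(R^K)` with `K ≤ 2lo`.
Numerics: memo §1 (code/exp21.py, exp22.py; exact rationals, 0 failures); the mixture identity and the expansion are g31's (ARM-REF g188/g190 countersigned).

HONEST STATUS.  Longer tails `K > 2lo` stay open at the forest level (the piece beside a blob needs a third route for `K > 2lo`; the hubs of width `lo·j ≤ K`
need torque-cost routes; memo §3); `SiblingStep` (all tree-OK forests), `GluedDominatedMass`, `SDECConvClosed`, `FarTreeRow` OPEN; RATE class (log\*) / honest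
sentence of `run/shared/lean/prim/quant/README.md` unchanged.  [this work].  Nothing here is cited as a published result.  The gluing rows served
[cite: KozmaNitzan2024, Conjecture 3 (p. 15)]; product measure [cite: Grimmett1999, §1.3 p. 10].
-/

noncomputable section

open scoped BigOperators

namespace Summit.CriticalPhenomena.PercolationContinuityZ3.Theorems
namespace Quant
namespace LawDec

open Finset

/-- the point mass `δ_K` -/
local notation3 "δ[" K "]" => (fun k : ℕ => if k = (K : ℕ) then (1 : ℝ) else 0)

/-- the FAR-GIANT PIECE / sub-forest law of shape `(lo, K)`: `S(γ) = {lo: 1−γ, lo+K: γ}` -/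
local notation3 "SP[" lo ", " K ", " a "]" => (fun h : ℕ => (1 - (a : ℝ)) * (if h = (lo : ℕ) then (1 : ℝ) else 0) +
  (a : ℝ) * (if h = (lo : ℕ) + (K : ℕ) then (1 : ℝ) else 0))

/-! ### The hub of every width, every shape `lo < K ≤ 2lo` -/

/-- **THE SUB-FLOOR HUB OF SHAPE `(lo, K)` OF EVERY WIDTH IS SDEC, FOR EVERY `lo < K ≤ 2lo`.**  For every list `P` of `j ≥ 2` gates with `lo ≤ Kγ`
(far-giant), `γ < 1` and `x(lo+K) ≤ lo + Kγ` (affordable) for `γ ∈ P`, and every floor `0 < x`: `SDEC x ((lo+K)j) (sHub lo K P)` — widths 2 and 3 by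
`sdec_sHub_two` / `sdec_sHub_three` (`…QuantShapeHubNarrow`), widths `≥ 4` by `sdec_sHub_wide` (`…QuantShapeHubWide`).  (g31's `sdec_sHub` had
`2K ≤ 3lo`.) [this work] -/
theorem sdec_sHub_twoLo (lo K : ℕ) (hloK : lo < K) (hK2 : K ≤ 2 * lo) {x : ℝ} (hx0 : 0 < x) :
    ∀ P : List ℝ, 2 ≤ P.length → (∀ γ ∈ P, (lo : ℝ) ≤ K * γ ∧ γ < 1 ∧ x * ((lo : ℝ) + K) ≤ lo + K * γ) →
    SDEC x ((lo + K) * P.length) (sHub lo K P) := by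
  intro P hP2 hP
  rcases (by omega : P.length = 2 ∨ P.length = 3 ∨ 4 ≤ P.length) with h | h | h
  · exact sdec_sHub_two lo K hloK hK2 hx0 P h hP
  · exact sdec_sHub_three lo K hloK hK2 hx0 P h hP
  · exact sdec_sHub_wide lo K hloK hK2 hx0 P h hP

/-! ### The expansion for forests of glued siblings of shape `(lo, K)`, `K ≤ 2lo` -/

/-- **THE INVARIANT** of the k-fold piece expansion for glued siblings of shape `(lo, K)` (`lo < K ≤ 2lo`), `G = sHub P ∗ flaw L`:
(1) law facts (mean `Σ_P (lo + Kγ) + fmean L`); (2) `G` SDEC unless `|P| = 1 ∧ L = []`; (3) `G ∗ gate δ_B(θ)` SDEC for every big heavy blob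
`2lo ≤ Bθ`, `θ < 1`, `x ≤ θ` (`B = lo+K`). [this work] -/
theorem shapeForest_inv_twoLo (lo K : ℕ) (hloK : lo < K) (hK2 : K ≤ 2 * lo) {x : ℝ} (hx0 : 0 < x) (hx1 : x < 1) : ∀ L : List Sib,
    (∀ s ∈ L, s.M = lo + K ∧ 0 < s.q ∧ s.q < 1 ∧ ∃ g : ℝ, 0 < g ∧ g < 1 ∧ s.ρ = SP[lo, K, g] ∧
      2 * (lo : ℝ) ≤ s.q * ((lo : ℝ) + K * g) ∧ x ≤ s.q * g) →
    ∀ P : List ℝ, (∀ γ ∈ P, (lo : ℝ) ≤ K * γ ∧ γ < 1 ∧ x * ((lo : ℝ) + K) ≤ lo + K * γ) →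
      ((∀ h, 0 ≤ lconv ((lo + K) * P.length) (ftop L) (sHub lo K P) (flaw L) h) ∧
        (∀ h, (lo + K) * P.length + ftop L < h → lconv ((lo + K) * P.length) (ftop L) (sHub lo K P) (flaw L) h = 0) ∧
        ∑ h ∈ Finset.range ((lo + K) * P.length + ftop L + 1), lconv ((lo + K) * P.length) (ftop L) (sHub lo K P) (flaw L) h = 1 ∧
        ∑ h ∈ Finset.range ((lo + K) * P.length + ftop L + 1), (h : ℝ) * lconv ((lo + K) * P.length) (ftop L) (sHub lo K P) (flaw L) h
          = (P.map (fun γ => (lo : ℝ) + K * γ)).sum + fmean L) ∧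
      ((P.length ≠ 1 ∨ L ≠ []) → SDEC x ((lo + K) * P.length + ftop L) (lconv ((lo + K) * P.length) (ftop L) (sHub lo K P) (flaw L))) ∧
      (∀ θ : ℝ, 2 * (lo : ℝ) ≤ ((lo : ℝ) + K) * θ → θ < 1 → x ≤ θ →
        SDEC x ((lo + K) * P.length + ftop L + (lo + K))
          (lconv ((lo + K) * P.length + ftop L) (lo + K) (lconv ((lo + K) * P.length) (ftop L) (sHub lo K P) (flaw L)) (gate δ[lo + K] θ)))
  | [], _ => by
    intro P hP
    have hlo : 1 ≤ lo := by omega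
    have hloR : (1 : ℝ) ≤ lo := by exact_mod_cast hlo
    have hKR : (lo : ℝ) < K := by exact_mod_cast hloK
    have hK2R : (K : ℝ) ≤ 2 * lo := by exact_mod_cast hK2
    have hhalf : ∀ γ ∈ P, 1 / 2 ≤ γ := fun γ h => by have := (hP γ h).1; nlinarith
    have hP01 : ∀ γ ∈ P, 0 ≤ γ ∧ γ ≤ 1 := fun γ h => ⟨by linarith [hhalf γ h], (hP γ h).2.1.le⟩
    obtain ⟨a0, aM, a1, am⟩ := sHub_laws lo K P hP01
    have eG : lconv ((lo + K) * P.length) (ftop []) (sHub lo K P) (flaw []) = sHub lo K P := by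
      funext h; exact lconv_delta_right _ _ _ aM h
    have eT : (lo + K) * P.length + ftop [] = (lo + K) * P.length := rfl
    rw [eG, eT]
    have hfm : fmean [] = 0 := rfl
    rw [hfm, add_zero]
    obtain ⟨hlo', _⟩ := shape_sum_bounds lo K x P (fun γ h => ⟨(hP γ h).2.1, (hP γ h).2.2⟩)
    have hta : x * (((lo + K) * P.length : ℕ) : ℝ) ≤ (P.map (fun γ => (lo : ℝ) + K * γ)).sum := by push_cast; linarith
    have c2 : (P.length ≠ 1 ∨ ([] : List Sib) ≠ []) → SDEC x ((lo + K) * P.length) (sHub lo K P) := by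
      intro hc
      have hne : P.length ≠ 1 := by
        rcases hc with h | h
        · exact h
        · exact absurd rfl h
      rcases Nat.lt_or_ge P.length 2 with hlt | hge
      · have h0 : P.length = 0 := by omega
        rw [h0, Nat.mul_zero]
        intro q _ _ j' hj'
        omega
      · exact sdec_sHub_twoLo lo K hloK hK2 hx0 P hge hP
    refine ⟨⟨a0, aM, a1, am⟩, c2, fun θ hθ hθ1 hxθ => ?_⟩
    by_cases h1 : P.length = 1
    · -- a lone far-giant piece beside a big heavy blob: `sdec_pieceBlob`
      obtain ⟨γ, rfl⟩ : ∃ γ, P = [γ] := by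
        rcases P with _ | ⟨γ, _ | ⟨γ', P'⟩⟩
        · simp at h1
        · exact ⟨γ, rfl⟩
        · simp at h1
      have hγ := hP γ (by simp)
      have cM : ∀ h, lo + K < h → SP[lo, K, γ] h = 0 := (sp_laws lo K (by linarith [hhalf γ (by simp)]) hγ.2.1.le).2.1
      have e0 : sHub lo K [γ] = SP[lo, K, γ] := funext fun h => lconv_delta_left _ (lo + K) _ cM h
      have e1 : (lo + K) * [γ].length = lo + K := by simp
      rw [e1, e0, lconv_comm (lo + K) (lo + K), show lo + K + (lo + K) = 2 * lo + 2 * K by ring]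
      exact sdec_pieceBlob lo K hloK hK2 hx0 (hhalf γ (by simp)) hγ.2.1 (by nlinarith) hθ1 hθ hxθ hγ.2.2
    · exact (sdec_blob_step (lo + K) hx0 hx1 hxθ hθ1.le a0 aM a1 am hta (c2 (Or.inl h1))).2.2.2.2
  | s :: L, hL => by
    intro P hP
    have hlo : 1 ≤ lo := by omega
    have hK1 : 1 ≤ K := by omega
    have hloR : (1 : ℝ) ≤ lo := by exact_mod_cast hlo
    have hKR : (lo : ℝ) < K := by exact_mod_cast hloK
    have hB0 : (0 : ℝ) < (lo : ℝ) + K := by linarith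
    have hK0 : (0 : ℝ) < K := by linarith
    obtain ⟨hM, hq0, hq1, g, hg0, hg1, hρ, hm, hxg⟩ := hL s (by simp)
    have hL' : ∀ s' ∈ L, s'.M = lo + K ∧ 0 < s'.q ∧ s'.q < 1 ∧ ∃ g : ℝ, 0 < g ∧ g < 1 ∧ s'.ρ = SP[lo, K, g] ∧
        2 * (lo : ℝ) ≤ s'.q * ((lo : ℝ) + K * g) ∧ x ≤ s'.q * g := fun s' h' => hL s' (List.mem_cons_of_mem s h')
    obtain ⟨q, x₁, n, M, ρ⟩ := s
    simp only at hM hq0 hq1 hρ hm hxg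
    subst hM
    subst hρ
    -- parameters of the glued sibling
    set m : ℝ := q * ((lo : ℝ) + K * g) with hmdef
    set α : ℝ := ((lo : ℝ) + K) * (1 - q) / (((lo : ℝ) + K) - m) with hα
    set γ : ℝ := (m - lo) / K with hγ
    set θs : ℝ := m / ((lo : ℝ) + K) with hθs
    obtain ⟨_, hα0, hα1, hbigs, hθs1, hxθs, hloγ, hγh, hγ1, hxP⟩ := shapeSib_params lo K hloK hK2 hq0 hq1 hg1 hm hxg
    have hθs0 : 0 ≤ θs := le_trans hx0.le hxθs
    have hQ : ∀ γ' ∈ γ :: P, (lo : ℝ) ≤ K * γ' ∧ γ' < 1 ∧ x * ((lo : ℝ) + K) ≤ lo + K * γ' := by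
      intro γ' h'
      rcases List.mem_cons.1 h' with rfl | h'
      · exact ⟨hloγ, hγ1, hxP⟩
      · exact hP γ' h'
    obtain ⟨⟨a0, aM, a1, am⟩, _, a3⟩ := shapeForest_inv_twoLo lo K hloK hK2 hx0 hx1 L hL' P hP
    obtain ⟨⟨b0, bM, b1, bm⟩, b2, _⟩ := shapeForest_inv_twoLo lo K hloK hK2 hx0 hx1 L hL' (γ :: P) hQ
    obtain ⟨hft, hfm⟩ := shapeSibs_ftop_fmean lo K L hL'
    obtain ⟨hlo', _⟩ := shape_sum_bounds lo K x P (fun γ' h => ⟨(hP γ' h).2.1, (hP γ' h).2.2⟩)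
    set N : ℕ := (lo + K) * P.length + ftop L with hN
    set G : ℕ → ℝ := lconv ((lo + K) * P.length) (ftop L) (sHub lo K P) (flaw L) with hG
    set X₁ : ℕ → ℝ := lconv N (lo + K) G (gate δ[lo + K] θs) with hX₁
    set X₂ : ℕ → ℝ := lconv ((lo + K) * P.length + (lo + K)) (ftop L) (sHub lo K (γ :: P)) (flaw L) with hX₂
    have hsmean : Sib.mean ⟨q, x₁, n, lo + K, SP[lo, K, g]⟩ = (lo : ℝ) + K * g := (sp_laws lo K hg0.le hg1.le).2.2.2
    have eflaw : flaw (⟨q, x₁, n, lo + K, SP[lo, K, g]⟩ :: L) = lconv (ftop L) (lo + K) (flaw L) (gate SP[lo, K, g] q) := rfl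
    have eftop : ftop (⟨q, x₁, n, lo + K, SP[lo, K, g]⟩ :: L) = ftop L + (lo + K) := rfl
    have efmean : fmean (⟨q, x₁, n, lo + K, SP[lo, K, g]⟩ :: L) = fmean L + m := by
      show fmean L + q * Sib.mean ⟨q, x₁, n, lo + K, SP[lo, K, g]⟩ = _; rw [hsmean]
    rw [eflaw, eftop, efmean]
    simp only [List.length_cons] at b0 bM b1 bm b2
    rw [show (lo + K) * (P.length + 1) = (lo + K) * P.length + (lo + K) by ring] at b0 bM b1 bm b2
    rw [show (lo + K) * P.length + (lo + K) + ftop L = N + (lo + K) by rw [hN]; ring] at bM b1 bm b2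
    -- the mixture identity
    have hmix : ∀ h, lconv ((lo + K) * P.length) (ftop L + (lo + K)) (sHub lo K P) (lconv (ftop L) (lo + K) (flaw L) (gate SP[lo, K, g] q)) h
        = α * X₁ h + (1 - α) * X₂ h := by
      intro h
      rw [lconv_assoc, lconv_mix_right _ _ _ _ _ _ α (fun k => gate_shapeSib_eq_mix lo K hlo hK1 hq1 hg0.le hg1.le k) h, hX₁, hX₂,
        ← shapeForest_piece lo K P L γ]
    have eNt : (lo + K) * P.length + (ftop L + (lo + K)) = N + (lo + K) := by rw [hN]; ring
    rw [eNt]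
    -- laws of `X₁`
    obtain ⟨bl0, _, bl1, blm⟩ := gateBlob_laws (lo + K) hθs0 hθs1.le
    obtain ⟨c0, cM, c1, cm⟩ := lconv_laws a0 a1 am bl0 bl1 blm
    have hX₁s : SDEC x (N + (lo + K)) X₁ := a3 θs hbigs hθs1 hxθs
    have eθm : (((lo + K : ℕ)) : ℝ) * θs = m := by rw [hθs]; push_cast; field_simp
    have eγm : (lo : ℝ) + K * γ = m := by rw [hγ]; field_simp; ring
    have cm' : ∑ h ∈ Finset.range (N + (lo + K) + 1), (h : ℝ) * X₁ h = (P.map (fun γ => (lo : ℝ) + K * γ)).sum + (fmean L + m) := by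
      rw [hX₁, cm, eθm]; ring
    have bm' : ∑ h ∈ Finset.range (N + (lo + K) + 1), (h : ℝ) * X₂ h = (P.map (fun γ => (lo : ℝ) + K * γ)).sum + (fmean L + m) := by
      rw [hX₂, bm]; simp only [List.map_cons, List.sum_cons]; rw [eγm]; ring
    have main : ((∀ h, 0 ≤ lconv ((lo + K) * P.length) (ftop L + (lo + K)) (sHub lo K P) (lconv (ftop L) (lo + K) (flaw L) (gate SP[lo, K, g] q)) h) ∧
        (∀ h, N + (lo + K) < h →
          lconv ((lo + K) * P.length) (ftop L + (lo + K)) (sHub lo K P) (lconv (ftop L) (lo + K) (flaw L) (gate SP[lo, K, g] q)) h = 0) ∧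
        ∑ h ∈ Finset.range (N + (lo + K) + 1),
          lconv ((lo + K) * P.length) (ftop L + (lo + K)) (sHub lo K P) (lconv (ftop L) (lo + K) (flaw L) (gate SP[lo, K, g] q)) h = 1 ∧
        ∑ h ∈ Finset.range (N + (lo + K) + 1),
          (h : ℝ) * lconv ((lo + K) * P.length) (ftop L + (lo + K)) (sHub lo K P) (lconv (ftop L) (lo + K) (flaw L) (gate SP[lo, K, g] q)) h
          = (P.map (fun γ => (lo : ℝ) + K * γ)).sum + (fmean L + m)) ∧
        SDEC x (N + (lo + K)) (lconv ((lo + K) * P.length) (ftop L + (lo + K)) (sHub lo K P) (lconv (ftop L) (lo + K) (flaw L) (gate SP[lo, K, g] q))) := by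
      by_cases hcorner : P = [] ∧ L = []
      · -- one glued sibling alone
        obtain ⟨rfl, rfl⟩ := hcorner
        obtain ⟨t0, tM, t1, tm⟩ := shapeSib_laws lo K hq0.le hq1.le hg0.le hg1.le
        have e1 : lconv (ftop []) (lo + K) (flaw []) (gate SP[lo, K, g] q) = gate SP[lo, K, g] q := funext fun h => lconv_delta_left 0 _ _ tM h
        have eidx : ftop ([] : List Sib) + (lo + K) = lo + K := by show 0 + (lo + K) = lo + K; omega
        rw [eidx]
        have e2 : lconv ((lo + K) * ([] : List ℝ).length) (lo + K) (sHub lo K []) (gate SP[lo, K, g] q) = gate SP[lo, K, g] q :=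
          funext fun h => lconv_delta_left _ _ _ tM h
        have hN3 : N + (lo + K) = lo + K := by rw [hN]; simp [ftop]
        rw [e1, e2, hN3]
        refine ⟨⟨t0, tM, t1, by rw [tm, hmdef]; simp [fmean]⟩, sdec_shapeSib lo K hlo hK1 hx0 hq0 hq1 hg1 hxg⟩
      · have hcond : (γ :: P).length ≠ 1 ∨ L ≠ [] := by
          by_cases hPn : P = []
          · exact Or.inr (fun hLn => hcorner ⟨hPn, hLn⟩)
          · left; simp only [List.length_cons]; intro h; exact hPn (List.length_eq_zero_iff.1 (by omega))
        have hX₂s : SDEC x (N + (lo + K)) X₂ := b2 hcond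
        obtain ⟨r0, rM, r1, rm, rS⟩ := sdec_mix_laws hα0 hα1 hmix c0 cM c1 cm' b0 bM b1 bm' hX₁s hX₂s
        exact ⟨⟨r0, rM, r1, rm⟩, rS⟩
    obtain ⟨⟨r0, rM, r1, rm⟩, rS⟩ := main
    refine ⟨⟨r0, rM, r1, rm⟩, fun _ => rS, fun θ hθ hθ1 hxθ => ?_⟩
    have hta : x * ((N + (lo + K) : ℕ) : ℝ) ≤ (P.map (fun γ => (lo : ℝ) + K * γ)).sum + (fmean L + m) := by
      rw [hN]; push_cast
      have h1 : x * ((ftop L : ℕ) : ℝ) ≤ fmean L := hfm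
      have h2 : x * ((lo : ℝ) + K) ≤ m := by rw [← eγm]; exact hxP
      have e : x * (((lo : ℝ) + K) * (P.length : ℝ) + (ftop L : ℕ) + ((lo : ℝ) + K))
          = x * ((lo : ℝ) + K) * (P.length : ℝ) + x * ((ftop L : ℕ) : ℝ) + x * ((lo : ℝ) + K) := by ring
      rw [e]; linarith [hlo', h1, h2]
    exact (sdec_blob_step (lo + K) hx0 hx1 hxθ hθ1.le r0 rM r1 rm hta rS).2.2.2.2

/-- **EVERY FOREST OF GLUED SIBLINGS `R^lo[q₁](R^K[g₁]) ⊔ … ⊔ R^lo[q_k](R^K[g_k])` OF A COMMON SHAPE `lo < K ≤ 2lo`, EVERY WIDTH, IS SDEC AT EVERY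
FLOOR `x ≤ min qᵢgᵢ` — ORACLE-FREE**, in the far-giant regime `mᵢ = qᵢ(lo + Kgᵢ) ≥ 2lo` (every sibling heavy-unfloored).  The sibling data:
`s = ⟨q, ·, ·, lo+K, S(g)⟩`, `S(g) = {lo: 1−g, lo+K: g}` (`= slice δ_lo K g`, arm-1 g49's `gluedSib lo K q g ·`). [this work] -/
theorem sdec_shapeForest_twoLo (lo K : ℕ) (hloK : lo < K) (hK2 : K ≤ 2 * lo) {x : ℝ} (hx0 : 0 < x) (L : List Sib)
    (hL : ∀ s ∈ L, s.M = lo + K ∧ 0 < s.q ∧ s.q < 1 ∧ ∃ g : ℝ, 0 < g ∧ g < 1 ∧ s.ρ = SP[lo, K, g] ∧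
      2 * (lo : ℝ) ≤ s.q * ((lo : ℝ) + K * g) ∧ x ≤ s.q * g) :
    SDEC x (ftop L) (flaw L) := by
  by_cases hnil : L = []
  · subst hnil; intro q _ _ j' hj'; exact absurd hj' (Nat.not_lt_zero _)
  · obtain ⟨s, hs⟩ := List.exists_mem_of_ne_nil L hnil
    have hx1 : x < 1 := by
      obtain ⟨_, hq0, hq1, g, hg0, hg1, _, _, hxg⟩ := hL s hs
      nlinarith
    have hLaw : ∀ s ∈ L, s.LawOK := by
      intro s hs
      obtain ⟨hM, hq0, hq1, g, hg0, hg1, hρ, _, _⟩ := hL s hs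
      obtain ⟨c0, cM, c1, _⟩ := sp_laws lo K hg0.le hg1.le
      refine ⟨hq0, hq1, ?_, ?_, ?_⟩
      · intro h; rw [hρ]; exact c0 h
      · intro h hh; rw [hρ]; exact cM h (by rw [hM] at hh; exact hh)
      · rw [hM, hρ]; exact c1
    obtain ⟨_, fM, _, _⟩ := flaw_facts L hLaw
    have h := (shapeForest_inv_twoLo lo K hloK hK2 hx0 hx1 L hL [] (fun γ h => by simp at h)).2.1 (Or.inl (by simp))
    have e : lconv ((lo + K) * ([] : List ℝ).length) (ftop L) (sHub lo K []) (flaw L) = flaw L := funext fun k => lconv_delta_left _ _ _ fM k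
    rw [e] at h
    simpa using h

/-! ### Every forest of glued siblings of one shape -/

/-- **EVERY FOREST OF GLUED SIBLINGS `R^lo(R^K)` OF ONE SHAPE `lo < K ≤ 2lo` IS SDEC AT EVERY TREE-OK FLOOR — ANY PARAMETERS, EVERY WIDTH, NO
ORACLE.**  For every list of siblings `⟨q,·,·,lo+K,{lo: 1−g, lo+K: g}⟩` with `0 < q, g < 1` and every floor `0 < x ≤ min qᵢgᵢ`: `SDEC x (ftop L) (flaw L)`.
Heavy siblings (`q(lo+Kg) ≥ 2lo`) by `sdec_shapeForest_twoLo`, light ones are tame (arm-1 g57's `sdec_cons_of_tame`). [this work] -/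
theorem sdec_shapeForests_all_twoLo (lo K : ℕ) (hloK : lo < K) (hK2 : K ≤ 2 * lo) {x : ℝ} (hx0 : 0 < x) (L : List Sib)
    (hL : ∀ s ∈ L, s.M = lo + K ∧ 0 < s.q ∧ s.q < 1 ∧ ∃ g : ℝ, 0 < g ∧ g < 1 ∧ s.ρ = SP[lo, K, g] ∧ x ≤ s.q * g) :
    SDEC x (ftop L) (flaw L) := by
  classical
  by_cases hnil : L = []
  · subst hnil; intro q _ _ j' hj'; exact absurd hj' (Nat.not_lt_zero _)
  obtain ⟨s₀, hs₀⟩ := List.exists_mem_of_ne_nil L hnil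
  have hx1 : x < 1 := by
    obtain ⟨_, hq0, hq1, g, hg0, hg1, _, hx⟩ := hL s₀ hs₀
    nlinarith
  have hlo : 1 ≤ lo := by omega
  have hloR : (1 : ℝ) ≤ lo := by exact_mod_cast hlo
  have facts : ∀ s ∈ L, s.LawOK ∧ x * (s.M : ℝ) ≤ s.q * s.mean ∧
      (∀ h : ℕ, 1 ≤ h → s.ρ h ≠ 0 → s.q * s.mean < 2 * lo → s.q * s.mean ≤ 2 * h) := by
    intro s hs
    obtain ⟨hM, hq0, hq1, g, hg0, hg1, hρ, hx⟩ := hL s hs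
    obtain ⟨c0, cM, c1, cm⟩ := sp_laws lo K hg0.le hg1.le
    have hmean : s.mean = (lo : ℝ) + K * g := by unfold Sib.mean; rw [hM, hρ]; exact cm
    refine ⟨⟨hq0, hq1, fun h => by rw [hρ]; exact c0 h, fun h hh => by rw [hρ]; exact cM h (by rw [hM] at hh; exact hh),
      by rw [hM, hρ]; exact c1⟩, ?_, ?_⟩
    · rw [hM, hmean]; push_cast
      have hB : (0 : ℝ) ≤ (lo : ℝ) + K := by positivity
      have h1 := mul_le_mul_of_nonneg_right hx hB
      have h2 : 0 ≤ s.q * (lo : ℝ) * (1 - g) := mul_nonneg (mul_nonneg hq0.le (Nat.cast_nonneg lo)) (by linarith)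
      nlinarith
    · intro h _ hh hlt
      have hat : h = lo ∨ h = lo + K := by
        by_contra hc
        push Not at hc
        apply hh; rw [hρ]; dsimp only; rw [if_neg hc.1, if_neg hc.2]; ring
      have : (lo : ℝ) ≤ h := by
        rcases hat with rfl | rfl
        · exact le_rfl
        · push_cast; linarith [(Nat.cast_nonneg K : (0 : ℝ) ≤ K)]
      linarith
  set b : Sib → Bool := fun s => decide (2 * (lo : ℝ) ≤ s.q * s.mean) with hb
  set Lh := L.filter b with hLh
  set Lt := L.filter (fun s => !b s) with hLt
  have hperm : (Lt ++ Lh).Perm L := (List.perm_append_comm).trans (List.filter_append_perm b L)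
  refine sdec_flaw_perm hperm ?_
  have hSh : SDEC x (ftop Lh) (flaw Lh) := by
    refine sdec_shapeForest_twoLo lo K hloK hK2 hx0 Lh fun s hs => ?_
    have hsL : s ∈ L := List.mem_of_mem_filter hs
    have hbs : 2 * (lo : ℝ) ≤ s.q * s.mean := by
      have := (List.mem_filter.1 hs).2
      simpa [hb] using this
    obtain ⟨hM, hq0, hq1, g, hg0, hg1, hρ, hx⟩ := hL s hsL
    obtain ⟨_, _, _, cm⟩ := sp_laws lo K hg0.le hg1.le
    have hmean : s.mean = (lo : ℝ) + K * g := by unfold Sib.mean; rw [hM, hρ]; exact cm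
    exact ⟨hM, hq0, hq1, g, hg0, hg1, hρ, by rw [← hmean]; exact hbs, hx⟩
  refine sdec_append_tame hx0 hx1 Lh (fun t ht => (facts t (List.mem_of_mem_filter ht)).1)
    (fun t ht => (facts t (List.mem_of_mem_filter ht)).2.1) hSh Lt (fun s hs => (facts s (List.mem_of_mem_filter hs)).1)
    (fun s hs => (facts s (List.mem_of_mem_filter hs)).2.1) ?_
  intro s hs h h1 hh
  have hsL : s ∈ L := List.mem_of_mem_filter hs
  have hbs : s.q * s.mean < 2 * lo := by
    have := (List.mem_filter.1 hs).2
    simp [hb] at this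
    exact this
  exact Or.inl ((facts s hsL).2.2 h h1 hh hbs)

end LawDec
end Quant
end Summit.CriticalPhenomena.PercolationContinuityZ3.Theorems
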